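import Literature.NumberTheory.Rogawski1990.TransferFactsMatrices
import Literature.NumberTheory.Rogawski1990.TestFunctionsPair
import Literature.NumberTheory.Rogawski1990.InnerTransferCentralValue
import Literature.NumberTheory.Rogawski1990.AdelicStableOrbitalCentralH
import Literature.NumberTheory.Automorphic.LocalUnitaryGroupSimilitudeLevel
import HarnessLib

/-!
# Central values of matched test functions — the bookkeeping lemmas [Rogawski1990, §14.5 p. 239; Lemma 14.5.2 (c)]

Topic `NumberTheory/Rogawski1990`.  KIT-FREE leaf of the T1 engine line's (F-0) anchor surgery (cell `pub/hodgecm-mathlib`, crux H413 =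
`stmt-HodgeConjecture-24833`; RULING #118 «leaves first»; author A-p06 (g21)).  Pure theorems over tree tokens, no `def`, no instance, no `sorry`:

* `UnitaryGroup.PureTensor.eval_eq_eval_of_forall_loc_eq` — two pure tensors (★ `TestFunctions`) whose local factors agree at two adelic points place by
  place, and whose archimedean factors agree there, have the same value (restricted-product bookkeeping: off `S_i` each factor is an indicator).
* `UnitaryGroup.PureTensor₂.eval_toAdelic_eq_zero_of_arch_eq_zero` — a pure tensor on `H(𝔸) = U(2) × U(1)` vanishes at a rational pair whose
  archimedean factor vanishes at `γ_H ⊗ 1` (★ `eval_eq_zero_of_arch_eq_zero`, ★ `archPart_cmDatum_toAdelic`).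
* `UnitaryGroup.PureTensor.eval_toAdelic_eq_of_loc_comp_symm_of_central` — «`f(ζ·1) = f′(ζ·1)`» for an inner-transfer pair of pure tensors
  (`T′_v = T_v ∘ ψ_v⁻¹`, `ψ_v` class-preserving): the finite factors agree at the central rational points by ★ N3
  `UnitaryGroup.loc_apply_eq_of_eq_comp_symm_of_central`, the archimedean ones by hypothesis. [Rogawski1990, §14.5 p. 239; §8.4]
* `UnitaryGroup.exists_psi_conj_corresponds_forall_levelMatching` — ★ `exists_psi_conj_forall_levelMatching` and ★
  `exists_psi_corresponds_forall_levelMatching` for ONE family `ψ_v` (conjugation formula ∧ `γ′ ↔ ψ_v γ′` ∧ `ψ_v⁻¹ γ ↔ γ` ∧ level matching off `S₀`).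
* `ArchCanonicalSingularMatrix.centralH_vanish` ∕ `.central_value` — the clauses (S-c) [Lemma 14.5.2 (c)] and (S-d) [§14.5 p. 239] of ★
  `ArchCanonicalSingularMatrix` (★ `TransferFactsMatrices`) BY NAME (the orbit-quotient σ-algebras are IMPLICIT binders `{i₁ … i₆}` — filled by unification from `h`, so a
  consumer holding `h` under `letI := borel _` applies them without instance search).

HC_CM is proved only modulo the printed citations until rung 0 closes; this file asserts nothing new.

## References
* [Rogawski1990] J. D. Rogawski, *Automorphic Representations of Unitary Groups in Three Variables*, Ann. of Math. Stud. 123 (1990): §14.1–14.2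
  pp. 232–233; §14.5 Lemma 14.5.2 (c) p. 238, p. 239; §8.4.  [BorelJacquet1979] A. Borel, H. Jacquet, *Automorphic forms and automorphic
  representations*, Proc. Sympos. Pure Math. 33.1 (1979), §4.1.
-/

set_option autoImplicit false

noncomputable section

open MeasureTheory Measure
open _root_.NumberField _root_.IsDedekindDomain
open scoped Matrix MatrixGroups

namespace Literature.NumberTheory.Automorphic.UnitaryGroup

open Literature.AlgebraicGeometry.ShimuraVarieties (hermForm)
open Literature.NumberTheory.Rogawski1990 (Corresponds cmRationalToArch archPart_cmDatum_toAdelic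
  coe_coe_cmDatum_toLocal_toAdelic_eq_smul_one_of_smul_one)

section Eval

variable {L : Type} [Field L] [NumberField L] [IsCMField L]
  {N₁ N₂ : ℕ} {H₁ : Matrix (Fin N₁) (Fin N₁) L} {H₂ : Matrix (Fin N₂) (Fin N₂) L}

/-- **Two pure tensors whose factors take the same values at two adelic points have the same value there**: if at EVERY finite place the local
factors agree, `T₂.loc v (g₂)_v = T₁.loc v (g₁)_v`, and the archimedean factors agree at `(g₂)_∞`, `(g₁)_∞`, then `T₂.eval g₂ = T₁.eval g₁` — the
restricted products coincide factor by factor (off `S_i` each factor is an indicator: a common value `≠ 1` outside `S₁ ∩ S₂` is `0` and kills both sides,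
otherwise both finite products collapse to the product over `S₁ ∪ S₂`).  The bookkeeping behind «`f(ζ·1) = f′(ζ·1)`» for a transfer pair whose local factors
match at the central points place by place. [cite: Rogawski1990, §14.2 p. 233; §14.5 p. 239] [cite: BorelJacquet1979, §4.1] -/
theorem PureTensor.eval_eq_eval_of_forall_loc_eq (T₁ : PureTensor L N₁ H₁) (T₂ : PureTensor L N₂ H₂)
    (g₁ : (cmDatum L N₁ H₁).Adelic) (g₂ : (cmDatum L N₂ H₂).Adelic)
    (hloc : ∀ v, T₂.loc v ((cmDatum L N₂ H₂).toLocal v g₂) = T₁.loc v ((cmDatum L N₁ H₁).toLocal v g₁))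
    (harch : T₂.arch (archPart (↥(maximalRealSubfield L)) L (IsCMField.complexConj L) N₂ H₂ g₂) =
      T₁.arch (archPart (↥(maximalRealSubfield L)) L (IsCMField.complexConj L) N₁ H₁ g₁)) :
    T₂.eval g₂ = T₁.eval g₁ := by
  classical
  -- off `S_i` the factor is the indicator of `K_i v`: value `1` on it, `0` off it
  have h1mem : ∀ v, v ∉ T₁.S → ((cmDatum L N₁ H₁).toLocal v g₁ ∈ T₁.K v ↔ T₁.loc v ((cmDatum L N₁ H₁).toLocal v g₁) = 1) := by
    intro v hv
    refine ⟨fun h => T₁.loc_apply_of_mem hv h, fun h => ?_⟩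
    by_contra hk
    rw [T₁.loc_apply_of_not_mem hv hk] at h
    exact zero_ne_one h
  have h2mem : ∀ v, v ∉ T₂.S → ((cmDatum L N₂ H₂).toLocal v g₂ ∈ T₂.K v ↔ T₂.loc v ((cmDatum L N₂ H₂).toLocal v g₂) = 1) := by
    intro v hv
    refine ⟨fun h => T₂.loc_apply_of_mem hv h, fun h => ?_⟩
    by_contra hk
    rw [T₂.loc_apply_of_not_mem hv hk] at h
    exact zero_ne_one h
  by_cases P₁ : ∀ v ∉ T₁.S, (cmDatum L N₁ H₁).toLocal v g₁ ∈ T₁.K v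
  · by_cases P₂ : ∀ v ∉ T₂.S, (cmDatum L N₂ H₂).toLocal v g₂ ∈ T₂.K v
    · rw [eval_eq_of_forall_mem T₁ g₁ P₁, eval_eq_of_forall_mem T₂ g₂ P₂, harch]
      congr 1
      have e1 : ∏ v ∈ T₁.S, T₁.loc v ((cmDatum L N₁ H₁).toLocal v g₁) = ∏ v ∈ T₁.S ∪ T₂.S, T₁.loc v ((cmDatum L N₁ H₁).toLocal v g₁) :=
        Finset.prod_subset Finset.subset_union_left fun v _ hv => (h1mem v hv).1 (P₁ v hv)
      have e2 : ∏ v ∈ T₂.S, T₂.loc v ((cmDatum L N₂ H₂).toLocal v g₂) = ∏ v ∈ T₁.S ∪ T₂.S, T₂.loc v ((cmDatum L N₂ H₂).toLocal v g₂) :=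
        Finset.prod_subset Finset.subset_union_right fun v _ hv => (h2mem v hv).1 (P₂ v hv)
      rw [e1, e2]
      exact Finset.prod_congr rfl fun v _ => hloc v
    · -- some factor of `T₂` off `S₂` vanishes, and the same value sits in `T₁`'s product
      push Not at P₂
      obtain ⟨v, hvS, hvK⟩ := P₂
      have h0 : T₁.loc v ((cmDatum L N₁ H₁).toLocal v g₁) = 0 := by rw [← hloc v]; exact T₂.loc_apply_of_not_mem hvS hvK
      have hv1 : v ∈ T₁.S := by
        by_contra hv1
        have := (h1mem v hv1).1 (P₁ v hv1)
        rw [h0] at this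
        exact zero_ne_one this
      rw [eval_eq_zero_of_not_mem T₂ g₂ hvS hvK, eval_eq_of_forall_mem T₁ g₁ P₁, Finset.prod_eq_zero hv1 h0, mul_zero]
  · push Not at P₁
    obtain ⟨v, hvS, hvK⟩ := P₁
    have h0 : T₂.loc v ((cmDatum L N₂ H₂).toLocal v g₂) = 0 := by rw [hloc v]; exact T₁.loc_apply_of_not_mem hvS hvK
    rw [eval_eq_zero_of_not_mem T₁ g₁ hvS hvK]
    by_cases P₂ : ∀ w ∉ T₂.S, (cmDatum L N₂ H₂).toLocal w g₂ ∈ T₂.K w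
    · have hv2 : v ∈ T₂.S := by
        by_contra hv2
        have := (h2mem v hv2).1 (P₂ v hv2)
        rw [h0] at this
        exact zero_ne_one this
      rw [eval_eq_of_forall_mem T₂ g₂ P₂, Finset.prod_eq_zero hv2 h0, mul_zero]
    · push Not at P₂
      obtain ⟨w, hwS, hwK⟩ := P₂
      exact eval_eq_zero_of_not_mem T₂ g₂ hwS hwK

/-- **A pure tensor on `H(𝔸)` vanishes at a rational pair where its archimedean factor vanishes at `γ_H ⊗ 1`** (★ `eval_eq_zero_of_arch_eq_zero`
read through `(γ)_∞ = γ ⊗ 1`, ★ `archPart_cmDatum_toAdelic`). [cite: BorelJacquet1979, §4.1] [cite: Rogawski1990, Lemma 14.5.2 (c) p. 238] -/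
theorem PureTensor₂.eval_toAdelic_eq_zero_of_arch_eq_zero (T : PureTensor₂ L H₂ H₁) (γ₂ : (cmDatum L N₂ H₂).Rational)
    (γ₁ : (cmDatum L N₁ H₁).Rational) (h : T.arch (cmRationalToArch L N₂ H₂ γ₂, cmRationalToArch L N₁ H₁ γ₁) = 0) :
    T.eval ((cmDatum L N₂ H₂).toAdelic γ₂, (cmDatum L N₁ H₁).toAdelic γ₁) = 0 := by
  refine T.eval_eq_zero_of_arch_eq_zero ?_
  show T.arch (archPart _ L _ N₂ _ ((cmDatum L N₂ H₂).toAdelic γ₂), archPart _ L _ N₁ _ ((cmDatum L N₁ H₁).toAdelic γ₁)) = 0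
  rw [archPart_cmDatum_toAdelic, archPart_cmDatum_toAdelic]
  exact h

/-- **«`f(ζ·1) = f′(ζ·1)`» for an inner-transfer pair of pure tensors** `T` on `U(H)(𝔸)`, `T′` on `U(H′)(𝔸)` with `T′_v = T_v ∘ ψ_v⁻¹` at every finite
place, `ψ_v⁻¹` class-preserving: at rational central elements `γ₀ = ζ·1 ∈ U(H)(L⁺)`, `γ = ζ·1 ∈ U(H′)(L⁺)` the finite factors agree (★ N3
`loc_apply_eq_of_eq_comp_symm_of_central` at the scalar local matrices ★ `coe_coe_cmDatum_toLocal_toAdelic_eq_smul_one_of_smul_one`), so the values agree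
as soon as the archimedean factors do at `γ ⊗ 1`, `γ₀ ⊗ 1` (`eval_eq_eval_of_forall_loc_eq`). [cite: Rogawski1990, §14.5 p. 239; §14.2 pp. 232–233] -/
theorem PureTensor.eval_toAdelic_eq_of_loc_comp_symm_of_central {N : ℕ} {H H' : Matrix (Fin N) (Fin N) L}
    (T : PureTensor L N H) (T' : PureTensor L N H')
    (ψ : ∀ v : HeightOneSpectrum (𝓞 ↥(maximalRealSubfield L)), (cmDatum L N H).Local v ≃ₜ* (cmDatum L N H').Local v)
    (hψ : ∀ v (γ : (cmDatum L N H').Local v),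
      Corresponds (conjLocal L (IsCMField.complexConj L) v) ((adelicForm L N H).map (adeleToLocal L v))
        ((adelicForm L N H').map (adeleToLocal L v)) ((ψ v).symm γ) γ)
    (hloc : ∀ v, T'.loc v = T.loc v ∘ (ψ v).symm)
    {γ₀ : (cmDatum L N H).Rational} {γ : (cmDatum L N H').Rational} {ζ : L}
    (hγ₀ : ((γ₀.val : GL (Fin N) L) : Matrix (Fin N) (Fin N) L) = ζ • (1 : Matrix (Fin N) (Fin N) L))
    (hγ : ((γ.val : GL (Fin N) L) : Matrix (Fin N) (Fin N) L) = ζ • (1 : Matrix (Fin N) (Fin N) L))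
    (harch : T'.arch (cmRationalToArch L N H' γ) = T.arch (cmRationalToArch L N H γ₀)) :
    T'.eval ((cmDatum L N H').toAdelic γ) = T.eval ((cmDatum L N H).toAdelic γ₀) := by
  refine PureTensor.eval_eq_eval_of_forall_loc_eq T T' _ _ (fun v => ?_) ?_
  · exact loc_apply_eq_of_eq_comp_symm_of_central (ψ v) (hψ v) (T.loc v) (hloc v)
      (coe_coe_cmDatum_toLocal_toAdelic_eq_smul_one_of_smul_one hγ v) (coe_coe_cmDatum_toLocal_toAdelic_eq_smul_one_of_smul_one hγ₀ v)
  · rw [archPart_cmDatum_toAdelic, archPart_cmDatum_toAdelic]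
    exact harch

end Eval

section Psi

variable (L : Type) [Field L] [NumberField L] [IsCMField L]

/-- **ONE family `ψ_v : G′_v ≅ G_v` with all four readings** — matrix conjugation `g ↦ S⁻¹ g S` at every finite place (★ `exists_psi_conj_forall_levelMatching`),
hence `γ′ ↔ ψ_v γ′` and `ψ_v⁻¹ γ ↔ γ` (★ `corresponds_of_coe_eq_conj`, ★ `corresponds_symm_of_coe_eq_conj`), and level matching off `S₀`.
[cite: Rogawski1990, §14.1–14.2 (14.2.1) pp. 232–233] -/
theorem exists_psi_conj_corresponds_forall_levelMatching (H : Matrix (Fin 3) (Fin 3) L)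
    (hanis : ∀ x : Fin 3 → L, hermForm (cmConjRingHom L) H x x = 0 → x = 0) (hherm : (H.map (cmConjRingHom L))ᵀ = H) :
    ∃ (ψ : ∀ v : HeightOneSpectrum (𝓞 ↥(maximalRealSubfield L)), (cmDatum L 3 H).Local v ≃ₜ*
        (cmDatum L 3 (Matrix.of fun i j : Fin 3 => if i.val + j.val + 1 = 3 then (1 : L) else 0)).Local v)
      (S₀ : Finset (HeightOneSpectrum (𝓞 ↥(maximalRealSubfield L)))),
      (∀ v, ∃ S : GL (Fin 3) (LocalRing L v), ∀ g : (cmDatum L 3 H).Local v, ((ψ v g).val : GL (Fin 3) (LocalRing L v)) = S⁻¹ * g.val * S) ∧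
      (∀ v (γ' : (cmDatum L 3 H).Local v),
        Corresponds (conjLocal L (IsCMField.complexConj L) v) ((adelicForm L 3 H).map (adeleToLocal L v))
          ((adelicForm L 3 (Matrix.of fun i j : Fin 3 => if i.val + j.val + 1 = 3 then (1 : L) else 0)).map (adeleToLocal L v))
          γ' (ψ v γ')) ∧
      (∀ v (γ : (cmDatum L 3 (Matrix.of fun i j : Fin 3 => if i.val + j.val + 1 = 3 then (1 : L) else 0)).Local v),
        Corresponds (conjLocal L (IsCMField.complexConj L) v) ((adelicForm L 3 H).map (adeleToLocal L v))
          ((adelicForm L 3 (Matrix.of fun i j : Fin 3 => if i.val + j.val + 1 = 3 then (1 : L) else 0)).map (adeleToLocal L v))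
          ((ψ v).symm γ) γ) ∧
      ∀ v ∉ S₀, ∀ g, ψ v g ∈ cmLocalIntegralLevel L 3 (Matrix.of fun i j : Fin 3 => if i.val + j.val + 1 = 3 then (1 : L) else 0) v ↔
        g ∈ cmLocalIntegralLevel L 3 H v := by
  obtain ⟨ψ, S₀, hconj, hlev⟩ := exists_psi_conj_forall_levelMatching L H hanis hherm
  refine ⟨ψ, S₀, hconj, fun v γ' => ?_, fun v γ => ?_, hlev⟩
  · obtain ⟨S, hS⟩ := hconj v
    exact corresponds_of_coe_eq_conj (IsCMField.complexConj L) v (ψ v) S hS γ'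
  · obtain ⟨S, hS⟩ := hconj v
    exact corresponds_symm_of_coe_eq_conj (IsCMField.complexConj L) v (ψ v) S hS γ

end Psi

end Literature.NumberTheory.Automorphic.UnitaryGroup

namespace Literature.NumberTheory.Rogawski1990

open Literature.NumberTheory.Automorphic
open Literature.AlgebraicGeometry.ShimuraVarieties (unitaryGroup hermForm)

section ArchMatrix

variable {L : Type} [Field L] [NumberField L] [IsCMField L] {H' : Matrix (Fin 3) (Fin 3) L} {T : ArchTransferFactor L H'}
    [MeasurableSpace (UnitaryGroup.arch (↥(maximalRealSubfield L)) L (IsCMField.complexConj L) 3 H')]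
    [BorelSpace (UnitaryGroup.arch (↥(maximalRealSubfield L)) L (IsCMField.complexConj L) 3 H')]
    [MeasurableSpace (UnitaryGroup.arch (↥(maximalRealSubfield L)) L (IsCMField.complexConj L) 3
      (Matrix.of fun i j : Fin 3 => if i.val + j.val + 1 = 3 then (1 : L) else 0))]
    [BorelSpace (UnitaryGroup.arch (↥(maximalRealSubfield L)) L (IsCMField.complexConj L) 3
      (Matrix.of fun i j : Fin 3 => if i.val + j.val + 1 = 3 then (1 : L) else 0))]
    [MeasurableSpace (UnitaryGroup.arch (↥(maximalRealSubfield L)) L (IsCMField.complexConj L) 2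
            (Matrix.of fun i j : Fin 2 => if i.val + j.val + 1 = 2 then (1 : L) else 0) ×
          UnitaryGroup.arch (↥(maximalRealSubfield L)) L (IsCMField.complexConj L) 1
            (Matrix.of fun i j : Fin 1 => if i.val + j.val + 1 = 1 then (1 : L) else 0))]
    [BorelSpace (UnitaryGroup.arch (↥(maximalRealSubfield L)) L (IsCMField.complexConj L) 2
            (Matrix.of fun i j : Fin 2 => if i.val + j.val + 1 = 2 then (1 : L) else 0) ×
          UnitaryGroup.arch (↥(maximalRealSubfield L)) L (IsCMField.complexConj L) 1
            (Matrix.of fun i j : Fin 1 => if i.val + j.val + 1 = 1 then (1 : L) else 0))]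
    {ν' : Measure (UnitaryGroup.arch (↥(maximalRealSubfield L)) L (IsCMField.complexConj L) 3 H')}
    {ν : Measure (UnitaryGroup.arch (↥(maximalRealSubfield L)) L (IsCMField.complexConj L) 3
      (Matrix.of fun i j : Fin 3 => if i.val + j.val + 1 = 3 then (1 : L) else 0))}
    {νH : Measure (UnitaryGroup.arch (↥(maximalRealSubfield L)) L (IsCMField.complexConj L) 2
            (Matrix.of fun i j : Fin 2 => if i.val + j.val + 1 = 2 then (1 : L) else 0) ×
          UnitaryGroup.arch (↥(maximalRealSubfield L)) L (IsCMField.complexConj L) 1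
            (Matrix.of fun i j : Fin 1 => if i.val + j.val + 1 = 1 then (1 : L) else 0))}
    [IsFiniteMeasureOnCompacts ν'] [ν'.IsMulRightInvariant] [IsFiniteMeasureOnCompacts ν] [ν.IsMulRightInvariant]
    [IsFiniteMeasureOnCompacts νH] [νH.IsMulRightInvariant]
variable
    {i₁ : ∀ γ : UnitaryGroup.arch (↥(maximalRealSubfield L)) L (IsCMField.complexConj L) 3 H',
      MeasurableSpace (UnitaryGroup.arch (↥(maximalRealSubfield L)) L (IsCMField.complexConj L) 3 H' ⧸ Subgroup.centralizer ({γ} : Set (UnitaryGroup.arch (↥(maximalRealSubfield L)) L (IsCMField.complexConj L) 3 H')))}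
    {i₂ : ∀ γ : UnitaryGroup.arch (↥(maximalRealSubfield L)) L (IsCMField.complexConj L) 3 H',
      BorelSpace (UnitaryGroup.arch (↥(maximalRealSubfield L)) L (IsCMField.complexConj L) 3 H' ⧸ Subgroup.centralizer ({γ} : Set (UnitaryGroup.arch (↥(maximalRealSubfield L)) L (IsCMField.complexConj L) 3 H')))}
    {i₃ : ∀ γ : UnitaryGroup.arch (↥(maximalRealSubfield L)) L (IsCMField.complexConj L) 3 (Matrix.of fun i j : Fin 3 => if i.val + j.val + 1 = 3 then (1 : L) else 0),
      MeasurableSpace (UnitaryGroup.arch (↥(maximalRealSubfield L)) L (IsCMField.complexConj L) 3 (Matrix.of fun i j : Fin 3 => if i.val + j.val + 1 = 3 then (1 : L) else 0) ⧸ Subgroup.centralizer ({γ} : Set (UnitaryGroup.arch (↥(maximalRealSubfield L)) L (IsCMField.complexConj L) 3 (Matrix.of fun i j : Fin 3 => if i.val + j.val + 1 = 3 then (1 : L) else 0))))}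
    {i₄ : ∀ γ : UnitaryGroup.arch (↥(maximalRealSubfield L)) L (IsCMField.complexConj L) 3 (Matrix.of fun i j : Fin 3 => if i.val + j.val + 1 = 3 then (1 : L) else 0),
      BorelSpace (UnitaryGroup.arch (↥(maximalRealSubfield L)) L (IsCMField.complexConj L) 3 (Matrix.of fun i j : Fin 3 => if i.val + j.val + 1 = 3 then (1 : L) else 0) ⧸ Subgroup.centralizer ({γ} : Set (UnitaryGroup.arch (↥(maximalRealSubfield L)) L (IsCMField.complexConj L) 3 (Matrix.of fun i j : Fin 3 => if i.val + j.val + 1 = 3 then (1 : L) else 0))))}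
    {i₅ : ∀ a : (UnitaryGroup.arch (↥(maximalRealSubfield L)) L (IsCMField.complexConj L) 2 (Matrix.of fun i j : Fin 2 => if i.val + j.val + 1 = 2 then (1 : L) else 0) ×
          UnitaryGroup.arch (↥(maximalRealSubfield L)) L (IsCMField.complexConj L) 1 (Matrix.of fun i j : Fin 1 => if i.val + j.val + 1 = 1 then (1 : L) else 0)),
      MeasurableSpace ((UnitaryGroup.arch (↥(maximalRealSubfield L)) L (IsCMField.complexConj L) 2 (Matrix.of fun i j : Fin 2 => if i.val + j.val + 1 = 2 then (1 : L) else 0) ×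
          UnitaryGroup.arch (↥(maximalRealSubfield L)) L (IsCMField.complexConj L) 1 (Matrix.of fun i j : Fin 1 => if i.val + j.val + 1 = 1 then (1 : L) else 0)) ⧸ Subgroup.centralizer ({a} : Set (UnitaryGroup.arch (↥(maximalRealSubfield L)) L (IsCMField.complexConj L) 2 (Matrix.of fun i j : Fin 2 => if i.val + j.val + 1 = 2 then (1 : L) else 0) ×
          UnitaryGroup.arch (↥(maximalRealSubfield L)) L (IsCMField.complexConj L) 1 (Matrix.of fun i j : Fin 1 => if i.val + j.val + 1 = 1 then (1 : L) else 0))))}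
    {i₆ : ∀ a : (UnitaryGroup.arch (↥(maximalRealSubfield L)) L (IsCMField.complexConj L) 2 (Matrix.of fun i j : Fin 2 => if i.val + j.val + 1 = 2 then (1 : L) else 0) ×
          UnitaryGroup.arch (↥(maximalRealSubfield L)) L (IsCMField.complexConj L) 1 (Matrix.of fun i j : Fin 1 => if i.val + j.val + 1 = 1 then (1 : L) else 0)),
      BorelSpace ((UnitaryGroup.arch (↥(maximalRealSubfield L)) L (IsCMField.complexConj L) 2 (Matrix.of fun i j : Fin 2 => if i.val + j.val + 1 = 2 then (1 : L) else 0) ×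
          UnitaryGroup.arch (↥(maximalRealSubfield L)) L (IsCMField.complexConj L) 1 (Matrix.of fun i j : Fin 1 => if i.val + j.val + 1 = 1 then (1 : L) else 0)) ⧸ Subgroup.centralizer ({a} : Set (UnitaryGroup.arch (↥(maximalRealSubfield L)) L (IsCMField.complexConj L) 2 (Matrix.of fun i j : Fin 2 => if i.val + j.val + 1 = 2 then (1 : L) else 0) ×
          UnitaryGroup.arch (↥(maximalRealSubfield L)) L (IsCMField.complexConj L) 1 (Matrix.of fun i j : Fin 1 => if i.val + j.val + 1 = 1 then (1 : L) else 0))))}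
    {hanis : ∀ x : Fin 3 → L, hermForm (cmConjRingHom L) H' x x = 0 → x = 0}
    {m' : OrbitalMeasureFamily (UnitaryGroup.arch (↥(maximalRealSubfield L)) L (IsCMField.complexConj L) 3 H')}
        {m : OrbitalMeasureFamily (UnitaryGroup.arch (↥(maximalRealSubfield L)) L (IsCMField.complexConj L) 3
          (Matrix.of fun i j : Fin 3 => if i.val + j.val + 1 = 3 then (1 : L) else 0))}
        {mH : OrbitalMeasureFamily (UnitaryGroup.arch (↥(maximalRealSubfield L)) L (IsCMField.complexConj L) 2
            (Matrix.of fun i j : Fin 2 => if i.val + j.val + 1 = 2 then (1 : L) else 0) ×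
          UnitaryGroup.arch (↥(maximalRealSubfield L)) L (IsCMField.complexConj L) 1
            (Matrix.of fun i j : Fin 1 => if i.val + j.val + 1 = 1 then (1 : L) else 0))}
        {t' : ∀ γ' : UnitaryGroup.arch (↥(maximalRealSubfield L)) L (IsCMField.complexConj L) 3 H',
          Measure (Subgroup.centralizer ({γ'} : Set (UnitaryGroup.arch (↥(maximalRealSubfield L)) L (IsCMField.complexConj L) 3 H')))}
        {t : ∀ γ : UnitaryGroup.arch (↥(maximalRealSubfield L)) L (IsCMField.complexConj L) 3
            (Matrix.of fun i j : Fin 3 => if i.val + j.val + 1 = 3 then (1 : L) else 0),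
          Measure (Subgroup.centralizer ({γ} : Set (UnitaryGroup.arch (↥(maximalRealSubfield L)) L (IsCMField.complexConj L) 3
            (Matrix.of fun i j : Fin 3 => if i.val + j.val + 1 = 3 then (1 : L) else 0))))}
        {tH : ∀ γH : UnitaryGroup.arch (↥(maximalRealSubfield L)) L (IsCMField.complexConj L) 2
              (Matrix.of fun i j : Fin 2 => if i.val + j.val + 1 = 2 then (1 : L) else 0) ×
            UnitaryGroup.arch (↥(maximalRealSubfield L)) L (IsCMField.complexConj L) 1
              (Matrix.of fun i j : Fin 1 => if i.val + j.val + 1 = 1 then (1 : L) else 0),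
          Measure (Subgroup.centralizer ({γH} : Set (UnitaryGroup.arch (↥(maximalRealSubfield L)) L (IsCMField.complexConj L) 2
              (Matrix.of fun i j : Fin 2 => if i.val + j.val + 1 = 2 then (1 : L) else 0) ×
            UnitaryGroup.arch (↥(maximalRealSubfield L)) L (IsCMField.complexConj L) 1
              (Matrix.of fun i j : Fin 1 => if i.val + j.val + 1 = 1 then (1 : L) else 0))))}

/-- **Clause (S-c) of ★ `ArchCanonicalSingularMatrix` BY NAME** [Lemma 14.5.2 (c) at `v ∈ S₀`]: a `Δ′_∞`-transfer `a^H` of a smooth `a′` vanishes at the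
rational central pairs `γ_H = (ζ·1₂, ζ·1₁)`. [cite: Rogawski1990, Lemma 14.5.2 (c) p. 238] -/
theorem ArchCanonicalSingularMatrix.centralH_vanish (h : ArchCanonicalSingularMatrix L H' T ν' ν νH hanis m' m mH t' t tH) :
    ∀ (aH : (UnitaryGroup.arch (↥(maximalRealSubfield L)) L (IsCMField.complexConj L) 2 (Matrix.of fun i j : Fin 2 => if i.val + j.val + 1 = 2 then (1 : L) else 0) ×
    UnitaryGroup.arch (↥(maximalRealSubfield L)) L (IsCMField.complexConj L) 1 (Matrix.of fun i j : Fin 1 => if i.val + j.val + 1 = 1 then (1 : L) else 0)) → ℂ)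
    (a' : UnitaryGroup.arch (↥(maximalRealSubfield L)) L (IsCMField.complexConj L) 3 H' → ℂ),
    ArchSmooth₂ L aH → ArchSmooth L 3 H' a' → IsArchDeltaTransfer L H' T mH m' aH a' →
    ∀ (γH : (UnitaryGroup.cmDatum L 2 (Matrix.of fun i j : Fin 2 => if i.val + j.val + 1 = 2 then (1 : L) else 0)).Rational ×
    (UnitaryGroup.cmDatum L 1 (Matrix.of fun i j : Fin 1 => if i.val + j.val + 1 = 1 then (1 : L) else 0)).Rational) (ζ : L),
    (((γH.1 : unitaryGroup (cmConjRingHom L) (Matrix.of fun i j : Fin 2 => if i.val + j.val + 1 = 2 then (1 : L) else 0)).val : GL (Fin 2) L) :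
    Matrix (Fin 2) (Fin 2) L) = ζ • (1 : Matrix (Fin 2) (Fin 2) L) →
    (((γH.2 : unitaryGroup (cmConjRingHom L) (Matrix.of fun i j : Fin 1 => if i.val + j.val + 1 = 1 then (1 : L) else 0)).val : GL (Fin 1) L) :
    Matrix (Fin 1) (Fin 1) L) = ζ • (1 : Matrix (Fin 1) (Fin 1) L) →
    aH (cmRationalToArch L 2 (Matrix.of fun i j : Fin 2 => if i.val + j.val + 1 = 2 then (1 : L) else 0) γH.1,
    cmRationalToArch L 1 (Matrix.of fun i j : Fin 1 => if i.val + j.val + 1 = 1 then (1 : L) else 0) γH.2) = 0 :=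
  h.2.2.2.2.2.2.2.2.2.2.2.2.2.1

/-- **Clause (S-d) of ★ `ArchCanonicalSingularMatrix` BY NAME** [§14.5 p. 239; §8.4]: an inner transfer `a` of a smooth `a′` takes the same value at the
rational central elements. [cite: Rogawski1990, §14.5 p. 239] -/
theorem ArchCanonicalSingularMatrix.central_value (h : ArchCanonicalSingularMatrix L H' T ν' ν νH hanis m' m mH t' t tH) :
    ∀ (a' : UnitaryGroup.arch (↥(maximalRealSubfield L)) L (IsCMField.complexConj L) 3 H' → ℂ)
    (a : UnitaryGroup.arch (↥(maximalRealSubfield L)) L (IsCMField.complexConj L) 3 (Matrix.of fun i j : Fin 3 => if i.val + j.val + 1 = 3 then (1 : L) else 0) → ℂ),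
    ArchSmooth L 3 H' a' → ArchSmooth L 3 (Matrix.of fun i j : Fin 3 => if i.val + j.val + 1 = 3 then (1 : L) else 0) a →
    IsArchInnerTransfer L H' m' m a' a →
    ∀ (γ₀ : (UnitaryGroup.cmDatum L 3 H').Rational)
    (γ : (UnitaryGroup.cmDatum L 3 (Matrix.of fun i j : Fin 3 => if i.val + j.val + 1 = 3 then (1 : L) else 0)).Rational) (ζ : L),
    (((γ₀ : unitaryGroup (cmConjRingHom L) H').val : GL (Fin 3) L) : Matrix (Fin 3) (Fin 3) L) = ζ • (1 : Matrix (Fin 3) (Fin 3) L) →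
    (((γ : unitaryGroup (cmConjRingHom L) (Matrix.of fun i j : Fin 3 => if i.val + j.val + 1 = 3 then (1 : L) else 0)).val : GL (Fin 3) L) :
    Matrix (Fin 3) (Fin 3) L) = ζ • (1 : Matrix (Fin 3) (Fin 3) L) →
    a (cmRationalToArch L 3 (Matrix.of fun i j : Fin 3 => if i.val + j.val + 1 = 3 then (1 : L) else 0) γ) = a' (cmRationalToArch L 3 H' γ₀) :=
  h.2.2.2.2.2.2.2.2.2.2.2.2.2.2

end ArchMatrix

end Literature.NumberTheory.Rogawski1990
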